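import Summits.QuantumFields.YangMills.Theorems.BalabanUVNodesN08HaarCompatibilityGuardCrossing

/-!
# BalabanUVNodes ∕ N08 — THE OFF-AXIS CROSSING BONDS OF A COARSE BOND ARE PRIVATE AMONG ALL COARSE BONDS:
# no loop and no axis of ANY other coarse bond `c′ ≠ c` traverses a crossing bond of `c`, so `Ū(c′)` does not see `U(q_c)`
# (the block-pair locality behind the conditional independence of the guards — part 7A taken ACROSS coarse bonds)

WIDTH SEAT `pub-ymgap-dag-n08-w3` g4, `W-SEAT-START-LIST.md` v10 §0 (iii); item-3 lineage part 17 = part 7A (p596156 `…GuardCrossing`: the crossing bonds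
are private WITHIN the loop family of ONE coarse bond) extended ACROSS coarse bonds, 2026-08-28.  DAG node N08 = [Balaban1985UV3] Thm 1 p. 257 (compact) +
Thm 2 p. 272; key item K1⁷ `StabilityBAtRecordR13SepCoPH` (stmt-QuantumFields-20542), `--supports … --as helper`.  COUNT-NEUTRAL.

THE POINT.  The one-step extensive transport bound for print's averaging (n08-w1's (R4⁗)(a) at one step; parts 14∕16 of this lineage: per-fibre density
constant `K` ⇒ `density(Ū_*(dU)) ≤ E_U Π_c (1 + (K−1)·1[U guard-admitting at c])`) needs the expectation of a PRODUCT OVER COARSE BONDS of guard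
indicators, and its honest value `(1 + (K−1)s)^{#PBond(j+1)}` rests on ONE structural fact about [Balaban1987RG1] (0.4): the loop variables of a coarse bond
`c` read, among the inter-block bonds, only the bonds through the face between `B(c₋)` and `B(c₊)` — the central bond `β(c)` (pub-balaban's FACT (A),
`BlockAveragingHaarAC.eq_of_mem_walk_loopWord_of_eq_centralBond`) and the `L^{d−1} − 1` off-axis CROSSING BONDS `q_c(r)` of part 7A — and these face
bonds belong to NO loop and NO axis of any other coarse bond.  This file proves exactly that, in the generality of FACE BONDS:
* §1 (any coarse site `y′`, direction `μ`, transverse offsets `|m_ν| ≤ (L−1)∕2`; the FACE BOND `b = ⟨emb y′ + m + ((L−1)∕2)e_μ, μ⟩`): no staircase from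
  any block centre traverses `b` (`ne_face_of_mem_walk_stairWord`); a transported segment `[x, x′]`, `x = emb y + n`, traverses `b` only if `y = y′`, its
  direction is `μ` and `n` agrees with `m` transversally (`eq_of_mem_walk_replicate_of_eq_face`); the axis of `c` traverses `b` only if `c = ⟨y′, μ⟩` and `m` is
  longitudinal (`eq_of_mem_walk_line_of_eq_face`); hence ★ `eq_of_mem_walk_loopWord_of_eq_face`: a loop `Γ ∪ [x,x′] ∪ (−Γ′) ∪ (−c)` of (0.4) at `c`
  traverses `b` only if `c = ⟨y′, μ⟩` (the proofs are pub-balaban's central-bond proofs with transverse offsets carried along).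
* §2 for part 7A's crossing family `qv` of `c` (hypothesis `hqv`, longitudinal offsets `0`): ★★ `eq_of_mem_walk_loopWord_of_eq_cross` (a loop of `c′`
  traverses `qv i` only if `c′ = c`), `eq_of_mem_walk_axis_of_eq_cross` (an axis of `c′` never does, for non-central `i`: with 7A's
  `ne_cross_of_mem_walk_axis`), `eq_of_cross_eq_cross` (crossing bonds of distinct coarse bonds are distinct).
* §3 ★★★ LOCALITY: for `c′ ≠ c`, `loopHol (update U (qv i) g) c′ = loopHol U c′`, `axialAvg (update U (qv i) g) c′ = axialAvg U c′` (every `c′`, non-central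
  `i`), hence **`avgFun ℰ (update U (qv i) g) c′ = avgFun ℰ U c′`** and `Small ℰ (update U (qv i) g) c′ ↔ Small ℰ U c′` — the typed (0.4) averaging AND its
  small-field guard at `c′` do not see the crossing coordinates of `c` (every group, every small-loop average `ℰ`, standing range).

LOCATED USE (not typed here).  With part 7B (p596721: given the rest, the conjugated crossing loops of ONE bond are i.i.d. Haar) this is the input of
«the families `(R̃_{c,t})_t` are i.i.d. Haar JOINTLY over all `(c, t)`», hence of the independence of the events `E_c = {R̃_{c,·} pairwise 2δ-close} ⊇
{guard-admitting at c}` across coarse bonds and of `E_U Π_c(1 + (K−1)1[ga_c]) ≤ (1 + (K−1)s)^{#PBond(j+1)}`, `s = P(E_c)` (HOME note `N08-EML-JACOBIAN.md` §3).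

HONEST FRAMING.  Lattice combinatorics ([folklore]) about the printed loop words of (0.4); nothing of Bałaban's asserted; no measure statement here; E6′ NOT
decided; `hmass` NOT supplied; count-neutral; N08 NOT discharged; counts unmoved (typed 28∕28 · discharged 5∕27); one finite 𝕋⁴ programme at fixed ε — R4
closes the CONDITIONAL rung `BalabanLadder.UV` only; the Yang–Mills mass gap (Clay) is NOT proved; nothing continuum ∕ OS.  0 `sorry`, 0 `def`, standard axioms.
-/

noncomputable section

namespace Summit.QuantumFields.YangMills.BalabanUVNodes.N08HaarCompatibilityGuardCrossingPrivacy

open Function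
open Literature.MathematicalPhysics.QuantumFieldTheory.Balaban1983to89
open Literature.MathematicalPhysics.QuantumFieldTheory.Balaban1983to89.T4Continuum
open Literature.MathematicalPhysics.QuantumFieldTheory.Balaban1983to89.T4ReflectionCone (netDisp_append netDisp_replicate holAt_congr)
open Literature.MathematicalPhysics.QuantumFieldTheory.Balaban1983to89.AveragingRT (axialAvg two_mul_half_add_one)
open Literature.MathematicalPhysics.QuantumFieldTheory.Balaban1983to89.BlockAveraging (Idx off off_bounds loopHol Small corr avgFun)
open Literature.MathematicalPhysics.QuantumFieldTheory.Balaban1983to89.BlockAveragingHaarAC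
  (IsCentral centralBond openWord loopWord_eq_openWord_append walkEnd_openWord replicate_false_eq_wordRev flip_mem_walk_of_mem_walk_wordRev
    exists_take_of_mem_walk mem_walk_replicate L_dvd_of_emb_add_eq apply_eq_of_emb_add_eq eq_zero_of_L_dvd avgFun_of_not_small)
open Summit.QuantumFields.YangMills.BalabanUVNodes.N08HaarCompatibilityGuardCrossing (cross_src_apply cross_dir ne_cross_of_mem_walk_axis)

/-! ## §1 Face bonds: where a staircase, a transported segment, an axis, a loop can traverse one -/

section Face

variable {P : Params} {j : ℕ} (y' : Site P (j + 1)) (μ : Fin P.d) (m : Fin P.d → ℤ)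
  (hm : ∀ κ, -(((P.L - 1) / 2 : ℕ) : ℤ) ≤ m κ ∧ m κ ≤ (((P.L - 1) / 2 : ℕ) : ℤ)) {b : PBond P j} (hbdir : b.dir = μ)
  (hbsrc : ∀ ν, b.src ν = emb y' ν + (((if ν = μ then (((P.L - 1) / 2 : ℕ) : ℤ) else m ν : ℤ)) : ZMod (P.sitesPerDir j)))

include hbdir hbsrc in
/-- **NO STAIRCASE FROM A BLOCK CENTRE TRAVERSES A FACE BOND**: along `Γ ∈ G(y, x)` (offsets `|n_ν| ≤ (L−1)∕2`) every bond has longitudinal source offset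
`≤ (L−1)∕2 − 1` in its own direction, a face bond has `(L−1)∕2` (standing range). [cite: Balaban1987RG1, (0.3) p.252 (bookkeeping)] -/
theorem ne_face_of_mem_walk_stairWord (hj : j + 1 ≤ P.m + P.K) (y : Site P (j + 1)) (σ : Equiv.Perm (Fin P.d)) (n : Fin P.d → ℤ)
    (hn : ∀ κ, -(((P.L - 1) / 2 : ℕ) : ℤ) ≤ n κ ∧ n κ ≤ (((P.L - 1) / 2 : ℕ) : ℤ))
    {s : LStep P j} (hs : s ∈ walk (emb y) (stairWord σ n)) : s.bond ≠ b := by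
  intro hsb
  obtain ⟨k₁, k₂, h1, h2⟩ := exists_take_of_mem_walk _ _ s hs
  have hb1 := netDisp_take_stairWord σ n μ k₁
  have hb2 := netDisp_take_stairWord σ n μ k₂
  have hnd := hn μ
  have hdir : s.bond.dir = μ := by rw [hsb, hbdir]
  have h2d := h2 μ
  rw [if_pos hdir.symm] at h2d
  have hsrc : s.bond.src μ = b.src μ := by rw [hsb]
  rw [h1 μ, hbsrc μ, if_pos rfl] at hsrc
  have hdvd := L_dvd_of_emb_add_eq hj hsrc
  have hL := two_mul_half_add_one P
  have h0 := eq_zero_of_L_dvd hdvd (by omega) (by omega)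
  omega

include hm hbdir hbsrc in
/-- **WHERE A TRANSPORTED SEGMENT CAN TRAVERSE A FACE BOND**: if a bond of the straight run of `L` steps `+e_μ′` from `x = emb y + n` (`|n_ν| ≤ (L−1)∕2`) is the
face bond `b`, then `y = y′`, `μ′ = μ`, and `n_ν = m_ν` for `ν ≠ μ` (standing range). [cite: Balaban1987RG1, (0.4) p.253 (bookkeeping)] -/
theorem eq_of_mem_walk_replicate_of_eq_face (hj : j + 1 ≤ P.m + P.K) (y : Site P (j + 1)) (μ' : Fin P.d) (n : Fin P.d → ℤ)
    (hn : ∀ κ, -(((P.L - 1) / 2 : ℕ) : ℤ) ≤ n κ ∧ n κ ≤ (((P.L - 1) / 2 : ℕ) : ℤ))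
    {x : Site P j} (hx : ∀ ν, x ν = emb y ν + ((n ν : ℤ) : ZMod (P.sitesPerDir j)))
    {s : LStep P j} (hs : s ∈ walk x (List.replicate P.L (μ', true))) (hsb : s.bond = b) :
    y = y' ∧ μ' = μ ∧ ∀ ν, ν ≠ μ → n ν = m ν := by
  obtain ⟨hd, -, t', ht', hsrc⟩ := mem_walk_replicate hs
  have hdir : μ' = μ := by rw [← hd, hsb, hbdir]
  subst hdir
  have hL := two_mul_half_add_one P
  have key : ∀ ν, emb y ν + (((n ν + if ν = μ' then (t' : ℤ) else 0 : ℤ)) : ZMod (P.sitesPerDir j)) =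
      emb y' ν + (((if ν = μ' then (((P.L - 1) / 2 : ℕ) : ℤ) else m ν : ℤ)) : ZMod (P.sitesPerDir j)) := by
    intro ν
    have h1 := hsrc ν
    rw [hsb, hbsrc ν, hx ν] at h1
    rw [h1]; push_cast; ring
  have hn0 : ∀ ν, ν ≠ μ' → n ν = m ν := by
    intro ν hν
    have h1 := L_dvd_of_emb_add_eq hj (key ν)
    rw [if_neg hν, if_neg hν] at h1
    have hnν := hn ν; have hmν := hm ν
    have h0 := eq_zero_of_L_dvd h1 (by omega) (by omega)
    omega
  have hnμ : n μ' + t' = (((P.L - 1) / 2 : ℕ) : ℤ) := by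
    have h1 := L_dvd_of_emb_add_eq hj (key μ')
    rw [if_pos rfl, if_pos rfl] at h1
    have hnν := hn μ'
    have h0 := eq_zero_of_L_dvd h1 (by omega) (by omega)
    omega
  have hy : y = y' := by
    funext ν
    have kν := key ν
    by_cases hν : ν = μ'
    · subst hν
      rw [if_pos rfl, if_pos rfl, hnμ] at kν
      exact apply_eq_of_emb_add_eq hj kν
    · rw [if_neg hν, if_neg hν, hn0 ν hν, add_zero] at kν
      exact apply_eq_of_emb_add_eq hj kν
  exact ⟨hy, rfl, hn0⟩

include hm hbdir hbsrc in
/-- **WHERE AN AXIS CAN TRAVERSE A FACE BOND**: a bond of the straight line of `c` is the face bond `b` only if `c = ⟨y′, μ⟩` and `m` is longitudinal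
(`m_ν = 0`, `ν ≠ μ`) — i.e. `b = β(c)`. [cite: Balaban1987RG1, (0.4) p.253 (bookkeeping)] -/
theorem eq_of_mem_walk_line_of_eq_face (hj : j + 1 ≤ P.m + P.K) (c : PBond P (j + 1)) {s : LStep P j}
    (hs : s ∈ walk (emb c.src) (List.replicate P.L (c.dir, true))) (hsb : s.bond = b) : c = ⟨y', μ⟩ ∧ ∀ ν, ν ≠ μ → m ν = 0 := by
  have hL := two_mul_half_add_one P
  obtain ⟨hy, hd, h0⟩ := eq_of_mem_walk_replicate_of_eq_face y' μ m hm hbdir hbsrc hj c.src c.dir (fun _ => 0)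
    (fun κ => by constructor <;> omega) (x := emb c.src) (fun ν => by simp) hs hsb
  refine ⟨?_, fun ν hν => (h0 ν hν).symm⟩
  cases c
  simp only at hy hd
  subst hy; subst hd; rfl

include hm hbdir hbsrc in
/-- **WHERE THE OPEN PART `Γ ∪ [x,x′] ∪ (−Γ′)` OF A LOOP OF (0.4) AT `c` CAN TRAVERSE A FACE BOND**: only on the transported segment, and then `c = ⟨y′, μ⟩` and
the loop's transverse offsets are `m` (standing range). [cite: Balaban1987RG1, (0.4) p.253 (bookkeeping)] -/
theorem eq_of_mem_walk_openWord_of_eq_face (hj : j + 1 ≤ P.m + P.K) (c : PBond P (j + 1)) (r : Fin P.d → Fin P.L)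
    (σ σ' : Equiv.Perm (Fin P.d)) {s : LStep P j} (hs : s ∈ walk (emb c.src) (openWord P.L c.dir (off r) σ σ')) (hsb : s.bond = b) :
    c = ⟨y', μ⟩ ∧ ∀ ν, ν ≠ μ → off r ν = m ν := by
  have hn := off_bounds r
  unfold openWord at hs
  rw [walk_append, List.mem_append, walk_append, List.mem_append] at hs
  rcases hs with hs | hs | hs
  · exact absurd hsb (ne_face_of_mem_walk_stairWord y' μ m hbdir hbsrc hj c.src σ (off r) hn hs)
  · have hx : ∀ ν, walkEnd (emb c.src) (stairWord σ (off r)) ν = emb c.src ν + ((off r ν : ℤ) : ZMod (P.sitesPerDir j)) :=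
      fun ν => by rw [walkEnd_apply, netDisp_stairWord]
    obtain ⟨hy, hd, h0⟩ := eq_of_mem_walk_replicate_of_eq_face y' μ m hm hbdir hbsrc hj c.src c.dir (off r) hn hx hs hsb
    refine ⟨?_, h0⟩
    cases c
    simp only at hy hd
    subst hy; subst hd; rfl
  · have hstart : walkEnd (walkEnd (emb c.src) (stairWord σ (off r))) (List.replicate P.L (c.dir, true)) =
        walkEnd (emb c.tgt) (stairWord σ' (off r)) := by
      funext ν
      rw [walkEnd_apply, walkEnd_apply, walkEnd_apply, PBond.tgt, emb_shift_apply, netDisp_stairWord, netDisp_stairWord,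
        netDisp_replicate]
      by_cases hν : ν = c.dir
      · subst hν; simp only [if_true, mul_one]; push_cast; ring
      · simp [hν, Ne.symm hν]
    rw [hstart] at hs
    exact absurd hsb (ne_face_of_mem_walk_stairWord y' μ m hbdir hbsrc hj c.tgt σ' (off r) hn (s := ⟨s.bond, !s.fwd⟩)
      (flip_mem_walk_of_mem_walk_wordRev _ _ s hs))

include hm hbdir hbsrc in
/-- ★ **WHERE A LOOP OF (0.4) CAN TRAVERSE A FACE BOND**: a loop `Γ ∪ [x,x′] ∪ (−Γ′) ∪ (−c)` at `c` (index `i`) traverses the face bond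
`b = ⟨emb y′ + m + ((L−1)∕2)e_μ, μ⟩` only if `c = ⟨y′, μ⟩`; and then either on its transported segment (transverse offsets `= m`) or on the returning axis
(`m` longitudinal). [cite: Balaban1987RG1, (0.4) p.253 (bookkeeping)] -/
theorem eq_of_mem_walk_loopWord_of_eq_face (hj : j + 1 ≤ P.m + P.K) (c : PBond P (j + 1)) (i : Idx P) {s : LStep P j}
    (hs : s ∈ walk (emb c.src) (loopWord P.L c.dir (off i.1) i.2.1 i.2.2)) (hsb : s.bond = b) :
    c = ⟨y', μ⟩ ∧ ((∀ ν, ν ≠ μ → off i.1 ν = m ν) ∨ (∀ ν, ν ≠ μ → m ν = 0)) := by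
  rw [loopWord_eq_openWord_append, walk_append, List.mem_append] at hs
  rcases hs with hs | hs
  · obtain ⟨hc, h0⟩ := eq_of_mem_walk_openWord_of_eq_face y' μ m hm hbdir hbsrc hj c i.1 i.2.1 i.2.2 hs hsb
    exact ⟨hc, Or.inl h0⟩
  · rw [walkEnd_openWord, replicate_false_eq_wordRev] at hs
    obtain ⟨hc, h0⟩ := eq_of_mem_walk_line_of_eq_face y' μ m hm hbdir hbsrc hj c (flip_mem_walk_of_mem_walk_wordRev _ _ s hs) hsb
    exact ⟨hc, Or.inr h0⟩

end Face

/-! ## §2 The crossing bonds of part 7A are face bonds: no loop and no axis of another coarse bond traverses them -/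

section Cross

variable {P : Params} {j : ℕ} (c : PBond P (j + 1)) {ι : Type*} (rv : ι → (Fin P.d → Fin P.L)) (qv : ι → PBond P j)
  (hqv : ∀ i, qv i = ⟨walkEnd (emb c.src) (stairWord 1 (off (rv i)) ++ List.replicate ((P.L - 1) / 2) (c.dir, true)), c.dir⟩)
  (h0 : ∀ i, off (rv i) c.dir = 0)
include hqv h0

/-- The crossing bond `qv i` IS the face bond of `B(c₋)` in direction `μ` at transverse offset `off (rv i)`. [folklore] -/
theorem cross_src_apply_face (i : ι) (ν : Fin P.d) :
    (qv i).src ν = emb c.src ν + (((if ν = c.dir then (((P.L - 1) / 2 : ℕ) : ℤ) else off (rv i) ν : ℤ)) : ZMod (P.sitesPerDir j)) := by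
  rw [cross_src_apply c rv qv hqv]
  by_cases h : ν = c.dir
  · subst h; rw [if_pos rfl, if_pos rfl, h0, zero_add]
  · rw [if_neg h, if_neg h, add_zero]

/-- ★★ **A LOOP OF `c′` TRAVERSES A CROSSING BOND OF `c` ONLY IF `c′ = c`** (every index of `c′`, every crossing index of `c`; standing range).
[cite: Balaban1987RG1, (0.4) p.253 (bookkeeping)] -/
theorem eq_of_mem_walk_loopWord_of_eq_cross (hj : j + 1 ≤ P.m + P.K) (c' : PBond P (j + 1)) (i' : Idx P) (i : ι) {s : LStep P j}
    (hs : s ∈ walk (emb c'.src) (loopWord P.L c'.dir (off i'.1) i'.2.1 i'.2.2)) (hsq : s.bond = qv i) : c' = c := by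
  have h := (eq_of_mem_walk_loopWord_of_eq_face c.src c.dir (off (rv i)) (off_bounds (rv i)) (cross_dir c rv qv hqv i)
    (cross_src_apply_face c rv qv hqv h0 i) hj c' i' hs hsq).1
  rw [h]

/-- **NO LOOP OF ANOTHER COARSE BOND TRAVERSES A CROSSING BOND OF `c`.** [cite: Balaban1987RG1, (0.4) p.253 (bookkeeping)] -/
theorem ne_cross_of_mem_walk_loopWord_of_ne (hj : j + 1 ≤ P.m + P.K) {c' : PBond P (j + 1)} (hc' : c' ≠ c) (i' : Idx P) (i : ι)
    {s : LStep P j} (hs : s ∈ walk (emb c'.src) (loopWord P.L c'.dir (off i'.1) i'.2.1 i'.2.2)) : s.bond ≠ qv i :=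
  fun hsq => hc' (eq_of_mem_walk_loopWord_of_eq_cross c rv qv hqv h0 hj c' i' i hs hsq)

/-- **NO AXIS OF ANY COARSE BOND TRAVERSES AN OFF-AXIS CROSSING BOND OF `c`** (for `c′ ≠ c` by the face-bond analysis; for `c′ = c` by part 7A's
`ne_cross_of_mem_walk_axis`, the index being non-central). [cite: Balaban1987RG1, (0.4) p.253 (bookkeeping)] -/
theorem ne_cross_of_mem_walk_axis_all (hj : j + 1 ≤ P.m + P.K) {i : ι} (hc : ¬ IsCentral c (rv i, 1, 1)) (c' : PBond P (j + 1))
    {s : LStep P j} (hs : s ∈ walk (emb c'.src) (List.replicate P.L (c'.dir, true))) : s.bond ≠ qv i := by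
  intro hsq
  by_cases hc' : c' = c
  · subst hc'
    exact ne_cross_of_mem_walk_axis c' rv qv hqv hj hc hs hsq
  · exact hc' (by
      have h := (eq_of_mem_walk_line_of_eq_face c.src c.dir (off (rv i)) (off_bounds (rv i)) (cross_dir c rv qv hqv i)
        (cross_src_apply_face c rv qv hqv h0 i) hj c' hs hsq).1
      rw [h])

omit h0 in
/-- **CROSSING BONDS OF DISTINCT COARSE BONDS ARE DISTINCT** (two crossing families `qv`, `qv′` of `c ≠ c′` never share a bond; standing range). [folklore] -/
theorem ne_of_cross_eq_cross (hj : j + 1 ≤ P.m + P.K) (c' : PBond P (j + 1)) {ι' : Type*} (rv' : ι' → (Fin P.d → Fin P.L)) (qv' : ι' → PBond P j)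
    (hqv' : ∀ i, qv' i = ⟨walkEnd (emb c'.src) (stairWord 1 (off (rv' i)) ++ List.replicate ((P.L - 1) / 2) (c'.dir, true)), c'.dir⟩)
    {i : ι} {i' : ι'} (h : qv i = qv' i') : c = c' := by
  have hd : c.dir = c'.dir := by rw [← cross_dir c rv qv hqv i, ← cross_dir c' rv' qv' hqv' i', h]
  have hy : c.src = c'.src := by
    funext ν
    have hs : (qv i).src ν = (qv' i').src ν := by rw [h]
    rw [cross_src_apply c rv qv hqv, cross_src_apply c' rv' qv' hqv', ← hd] at hs
    have hb := off_bounds (rv i) ν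
    have hb' := off_bounds (rv' i') ν
    have hL := two_mul_half_add_one P
    have hdvd := L_dvd_of_emb_add_eq hj hs
    have he : (off (rv i) ν + if ν = c.dir then (((P.L - 1) / 2 : ℕ) : ℤ) else 0) =
        (off (rv' i') ν + if ν = c.dir then (((P.L - 1) / 2 : ℕ) : ℤ) else 0) := by
      have h0' := eq_zero_of_L_dvd hdvd (by split_ifs <;> omega) (by split_ifs <;> omega)
      omega
    rw [he] at hs
    exact apply_eq_of_emb_add_eq hj hs
  cases c; cases c'
  simp only at hd hy
  subst hd; subst hy; rfl

end Cross

/-! ## §3 Locality: `Ū(c′)`, its loop variables and its guard do not see the crossing coordinates of `c ≠ c′` -/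

section Locality

variable {P : Params} {j : ℕ} {G : Type*} [GaugeGroup G] [DecidableEq (PBond P j)] (c : PBond P (j + 1)) {ι : Type*}
  (rv : ι → (Fin P.d → Fin P.L)) (qv : ι → PBond P j)
  (hqv : ∀ i, qv i = ⟨walkEnd (emb c.src) (stairWord 1 (off (rv i)) ++ List.replicate ((P.L - 1) / 2) (c.dir, true)), c.dir⟩)
  (h0 : ∀ i, off (rv i) c.dir = 0)
include hqv h0

/-- ★ **THE LOOP VARIABLES OF `c′ ≠ c` DO NOT SEE `U(q_c)`.** [cite: Balaban1987RG1, (0.4) p.253 (bookkeeping)] -/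
theorem loopHol_update_cross_of_ne (hj : j + 1 ≤ P.m + P.K) {c' : PBond P (j + 1)} (hc' : c' ≠ c) (U : GaugeField P j G) (i : ι) (g : G) :
    loopHol (update U (qv i) g) c' = loopHol U c' := by
  funext i'
  unfold loopHol
  exact holAt_congr fun s hs => update_of_ne (ne_cross_of_mem_walk_loopWord_of_ne c rv qv hqv h0 hj hc' i' i hs) _ _

/-- **NO COARSE BOND VARIABLE `U(c′)` SEES AN OFF-AXIS CROSSING COORDINATE** (every `c′`, non-central `i`). [cite: Balaban1987RG1, (0.4) p.253 (bookkeeping)] -/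
theorem axialAvg_update_cross (hj : j + 1 ≤ P.m + P.K) {i : ι} (hc : ¬ IsCentral c (rv i, 1, 1)) (U : GaugeField P j G) (g : G)
    (c' : PBond P (j + 1)) : axialAvg (update U (qv i) g) c' = axialAvg U c' := by
  rw [axialAvg_eq_holAt_walk, axialAvg_eq_holAt_walk]
  exact holAt_congr fun s hs => update_of_ne (ne_cross_of_mem_walk_axis_all c rv qv hqv h0 hj hc c' hs) _ _

/-- ★ **THE GUARD OF `c′ ≠ c` DOES NOT SEE `U(q_c)`**: `Small ℰ (U[q_c ↦ g]) c′ ↔ Small ℰ U c′`. [cite: Balaban1987RG1, (0.4) p.253 (bookkeeping)] -/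
theorem small_update_cross_iff_of_ne (ℰ : LoopAverage G) (hj : j + 1 ≤ P.m + P.K) {c' : PBond P (j + 1)} (hc' : c' ≠ c) (U : GaugeField P j G)
    (i : ι) (g : G) : Small ℰ (update U (qv i) g) c' ↔ Small ℰ U c' := by
  unfold BlockAveraging.Small
  rw [loopHol_update_cross_of_ne c rv qv hqv h0 hj hc' U i g]

/-- ★★★ **THE TYPED (0.4) AVERAGING AT `c′ ≠ c` DOES NOT SEE THE CROSSING COORDINATES OF `c`**: `Ū(c′)(U[q_c ↦ g]) = Ū(c′)(U)` for every group, every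
small-loop average `ℰ`, every non-central crossing index (standing range) — the block-pair locality of [Balaban1987RG1] (0.4) in the crossing coordinates,
companion of pub-balaban's `isLocal_avgFun` (the central coordinates). [cite: Balaban1987RG1, (0.4) p.253 (bookkeeping)] -/
theorem avgFun_update_cross_of_ne (ℰ : LoopAverage G) (hj : j + 1 ≤ P.m + P.K) {i : ι} (hc : ¬ IsCentral c (rv i, 1, 1)) {c' : PBond P (j + 1)}
    (hc' : c' ≠ c) (U : GaugeField P j G) (g : G) : avgFun ℰ (update U (qv i) g) c' = avgFun ℰ U c' := by
  by_cases hS : Small ℰ U c'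
  · have hS' : Small ℰ (update U (qv i) g) c' := (small_update_cross_iff_of_ne c rv qv hqv h0 ℰ hj hc' U i g).2 hS
    show corr ℰ (update U (qv i) g) c' * axialAvg (update U (qv i) g) c' = corr ℰ U c' * axialAvg U c'
    unfold corr
    rw [if_pos hS', if_pos hS, loopHol_update_cross_of_ne c rv qv hqv h0 hj hc' U i g, axialAvg_update_cross c rv qv hqv h0 hj hc U g c']
  · have hS' : ¬ Small ℰ (update U (qv i) g) c' := fun h => hS ((small_update_cross_iff_of_ne c rv qv hqv h0 ℰ hj hc' U i g).1 h)
    rw [avgFun_of_not_small ℰ _ _ hS', avgFun_of_not_small ℰ _ _ hS, axialAvg_update_cross c rv qv hqv h0 hj hc U g c']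

end Locality

end Summit.QuantumFields.YangMills.BalabanUVNodes.N08HaarCompatibilityGuardCrossingPrivacy
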